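import Mathlib
import Literature.MathematicalPhysics.KineticTheory.ZeroWavenumberSpace
import HarnessLib

/-!
# Covariances of translated local observables under half-line ρ-mixing (tools + box form)

Topic `Literature/MathematicalPhysics/KineticTheory`; theorems only (no definitions, no named facts),
companion of `ZeroWavenumberSpace.lean` (the lattice translations `chainShift`). Part 1 of the
**clustering transfer** (part 2: `InfiniteChainClusteringTransfer.lean`): the assembly step of the
space–time clustering of local observables of the infinite anharmonic chain (Buttà–Marchioro 2016 §3
locality + exponential mixing of the one-dimensional Gibbs state, Cassandro–Olivieri–Pellegrinotti–
Presutti 1978 §3), isolated as abstract measure theory on `ChainConfig = ℤ → ℝ × ℝ`.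
Inputs of the two files, all hypotheses:

* (M) **exponential ρ-mixing** of a probability measure `μ` between half-lines — verbatim the form of
  the registered statement `stub_regularMixing` of crux `GreenKuboContinuation` (line
  temperature-blind-vitali-hurwitz): for `f` depending on the sites `≤ p` and `g` on the sites
  `≥ p + n` (measurable, square integrable),
  `|∫ f g dμ - ∫ f dμ ∫ g dμ| ≤ C e^{-m n} (∫ f²)^{1/2} (∫ g²)^{1/2}`;
* invariance of `μ` under the lattice translations `τ_x = chainShift x` (for a shift-invariant
  state: `IsShiftInvariant.measurePreserving_chainShift`, `InfiniteChainGoodSetSymmetries.lean`);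
* a box-local square-integrable observable `a` (depends on the sites in `[-R, R]`);
* (L) **`L²`-locality** of a square-integrable observable `g` (typically `g = b ∘ φ_u`, an evolved
  local observable): for every `n`, an approximant `h_n` depending on the sites in
  `[-(n+K), n+K]` with `(∫ (g - h_n)²)^{1/2} ≤ ε_n`, `Σ ε_n < ∞`.

This file (tools and the box form of mixing):

* `abs_integral_mul_le_sqrt_integral_sq_mul`, `sqrt_integral_add_sq_le`,
  `abs_covariance_le_sqrt_integral_sq_mul` — Cauchy–Schwarz / Minkowski / Cauchy–Schwarz for
  covariances in the raw second-moment normalisation `(∫ f²)^{1/2}` used by (M);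
* `integral_comp_chainShift`, `integral_sq_comp_chainShift`, `dependsOn_comp_chainShift` —
  translation bookkeeping;
* `abs_covariance_comp_chainShift_le_of_mixing` — the two-sided BOX form of (M):
  `|Cov_μ(a, h ∘ τ_x)| ≤ max C 1 · e^{-m (|x|-M-R)₊} (∫ a²)^{1/2} (∫ h²)^{1/2}` for `h` depending on
  `[-M, M]` (Cauchy–Schwarz in the overlap regime `|x| < M + R`).

Everything is proved; tagged `[folklore]`.
-/

noncomputable section

open MeasureTheory ProbabilityTheory Filter Set Function
open scoped Topology

namespace Literature.MathematicalPhysics.KineticTheory.HeatConduction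

/-! ### §0 Tools: Cauchy–Schwarz in the `(∫ f²)^{1/2}` normalisation, covariances, translations -/

section Tools

variable {Ω : Type*} [MeasurableSpace Ω] {μ : Measure Ω}

/-- `∫ f² ≥ 0`. [folklore] -/
theorem integral_sq_nonneg' (f : Ω → ℝ) : 0 ≤ ∫ ω, f ω ^ 2 ∂μ :=
  integral_nonneg fun _ => sq_nonneg _

/-- **Cauchy–Schwarz** for real square-integrable functions:
`|∫ f g| ≤ (∫ f²)^{1/2} (∫ g²)^{1/2}`. [folklore] -/
theorem abs_integral_mul_le_sqrt_integral_sq_mul {f g : Ω → ℝ} (hf : MemLp f 2 μ) (hg : MemLp g 2 μ) :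
    |∫ ω, f ω * g ω ∂μ| ≤ Real.sqrt (∫ ω, f ω ^ 2 ∂μ) * Real.sqrt (∫ ω, g ω ^ 2 ∂μ) := by
  have h := integral_mul_norm_le_Lp_mul_Lq (μ := μ) (f := fun x => ‖f x‖) (g := fun x => ‖g x‖)
    Real.HolderConjugate.two_two (by simpa using hf.norm) (by simpa using hg.norm)
  simp only [Real.rpow_two, one_div, Real.norm_eq_abs, sq_abs, abs_abs] at h
  rw [Real.sqrt_eq_rpow, Real.sqrt_eq_rpow, one_div]
  refine le_trans ?_ h
  refine abs_integral_le_integral_abs.trans (le_of_eq ?_)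
  exact integral_congr_ae (Eventually.of_forall fun x => abs_mul _ _)

/-- **Minkowski** in the `(∫ f²)^{1/2}` normalisation: `(∫ (f+g)²)^{1/2} ≤ (∫ f²)^{1/2} + (∫ g²)^{1/2}`.
[folklore] -/
theorem sqrt_integral_add_sq_le {f g : Ω → ℝ} (hf : MemLp f 2 μ) (hg : MemLp g 2 μ) :
    Real.sqrt (∫ ω, (f ω + g ω) ^ 2 ∂μ) ≤
      Real.sqrt (∫ ω, f ω ^ 2 ∂μ) + Real.sqrt (∫ ω, g ω ^ 2 ∂μ) := by
  set A := Real.sqrt (∫ ω, f ω ^ 2 ∂μ) with hA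
  set B := Real.sqrt (∫ ω, g ω ^ 2 ∂μ) with hB
  have hA0 : 0 ≤ A := Real.sqrt_nonneg _
  have hB0 : 0 ≤ B := Real.sqrt_nonneg _
  have hf2 : Integrable (fun ω => f ω ^ 2) μ := hf.integrable_sq
  have hg2 : Integrable (fun ω => g ω ^ 2) μ := hg.integrable_sq
  have hfg : Integrable (fun ω => f ω * g ω) μ := hf.integrable_mul hg
  have hexp : ∫ ω, (f ω + g ω) ^ 2 ∂μ =
      (∫ ω, f ω ^ 2 ∂μ) + 2 * (∫ ω, f ω * g ω ∂μ) + ∫ ω, g ω ^ 2 ∂μ := by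
    have e : (fun ω => (f ω + g ω) ^ 2) = fun ω => (f ω ^ 2 + 2 * (f ω * g ω)) + g ω ^ 2 := by
      funext ω; ring
    have h1 : ∫ ω, (f ω ^ 2 + 2 * (f ω * g ω)) + g ω ^ 2 ∂μ =
        (∫ ω, f ω ^ 2 + 2 * (f ω * g ω) ∂μ) + ∫ ω, g ω ^ 2 ∂μ :=
      integral_add (hf2.add (hfg.const_mul 2)) hg2
    have h2 : ∫ ω, f ω ^ 2 + 2 * (f ω * g ω) ∂μ = (∫ ω, f ω ^ 2 ∂μ) + ∫ ω, 2 * (f ω * g ω) ∂μ :=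
      integral_add hf2 (hfg.const_mul 2)
    rw [e, h1, h2, integral_const_mul]
  have hcs := abs_integral_mul_le_sqrt_integral_sq_mul hf hg
  have hle : ∫ ω, (f ω + g ω) ^ 2 ∂μ ≤ (A + B) ^ 2 := by
    rw [hexp]
    have h1 : ∫ ω, f ω ^ 2 ∂μ = A ^ 2 := by rw [hA, Real.sq_sqrt (integral_sq_nonneg' f)]
    have h2 : ∫ ω, g ω ^ 2 ∂μ = B ^ 2 := by rw [hB, Real.sq_sqrt (integral_sq_nonneg' g)]
    rw [h1, h2]
    nlinarith [(abs_le.1 hcs).2]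
  calc Real.sqrt (∫ ω, (f ω + g ω) ^ 2 ∂μ) ≤ Real.sqrt ((A + B) ^ 2) := Real.sqrt_le_sqrt hle
    _ = A + B := Real.sqrt_sq (add_nonneg hA0 hB0)

/-- `(∫ (-f)²)^{1/2} = (∫ f²)^{1/2}`. [folklore] -/
theorem sqrt_integral_neg_sq (f : Ω → ℝ) :
    Real.sqrt (∫ ω, (-f ω) ^ 2 ∂μ) = Real.sqrt (∫ ω, f ω ^ 2 ∂μ) := by
  simp only [neg_sq]

/-- `(∫ h²)^{1/2} ≤ (∫ g²)^{1/2} + (∫ (g-h)²)^{1/2}`. [folklore] -/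
theorem sqrt_integral_sq_le_add_sqrt_integral_sub_sq {g h : Ω → ℝ} (hg : MemLp g 2 μ)
    (hh : MemLp h 2 μ) :
    Real.sqrt (∫ ω, h ω ^ 2 ∂μ) ≤
      Real.sqrt (∫ ω, g ω ^ 2 ∂μ) + Real.sqrt (∫ ω, (g ω - h ω) ^ 2 ∂μ) := by
  have h1 := sqrt_integral_add_sq_le hg (hg.sub hh).neg
  have e1 : (fun ω => (g ω + (-(g - h)) ω) ^ 2) = fun ω => h ω ^ 2 := by
    funext ω; simp only [Pi.neg_apply, Pi.sub_apply]; ring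
  have e2 : (fun ω => ((-(g - h)) ω) ^ 2) = fun ω => (g ω - h ω) ^ 2 := by
    funext ω; simp only [Pi.neg_apply, Pi.sub_apply]; ring
  simpa only [e1, e2] using h1

/-- **Cauchy–Schwarz for covariances** under a probability measure, in the raw second-moment form:
`|Cov(X, Y)| ≤ (∫ X²)^{1/2} (∫ Y²)^{1/2}` (the centred second moments are the variances, which are at
most the raw ones). [folklore] -/
theorem abs_covariance_le_sqrt_integral_sq_mul [IsProbabilityMeasure μ] {X Y : Ω → ℝ}
    (hX : MemLp X 2 μ) (hY : MemLp Y 2 μ) :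
    |cov[X, Y; μ]| ≤ Real.sqrt (∫ ω, X ω ^ 2 ∂μ) * Real.sqrt (∫ ω, Y ω ^ 2 ∂μ) := by
  have hXc : MemLp (fun ω => X ω - ∫ x, X x ∂μ) 2 μ := hX.sub (memLp_const _)
  have hYc : MemLp (fun ω => Y ω - ∫ x, Y x ∂μ) 2 μ := hY.sub (memLp_const _)
  have hcs := abs_integral_mul_le_sqrt_integral_sq_mul hXc hYc
  have hvarX : ∫ ω, (X ω - ∫ x, X x ∂μ) ^ 2 ∂μ ≤ ∫ ω, X ω ^ 2 ∂μ := by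
    rw [← variance_eq_integral hX.aestronglyMeasurable.aemeasurable, variance_eq_sub hX]
    simp only [Pi.pow_apply]
    nlinarith [sq_nonneg (∫ x, X x ∂μ)]
  have hvarY : ∫ ω, (Y ω - ∫ x, Y x ∂μ) ^ 2 ∂μ ≤ ∫ ω, Y ω ^ 2 ∂μ := by
    rw [← variance_eq_integral hY.aestronglyMeasurable.aemeasurable, variance_eq_sub hY]
    simp only [Pi.pow_apply]
    nlinarith [sq_nonneg (∫ x, Y x ∂μ)]
  calc |cov[X, Y; μ]| = |∫ ω, (X ω - ∫ x, X x ∂μ) * (Y ω - ∫ x, Y x ∂μ) ∂μ| := rfl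
    _ ≤ Real.sqrt (∫ ω, (X ω - ∫ x, X x ∂μ) ^ 2 ∂μ) * Real.sqrt (∫ ω, (Y ω - ∫ x, Y x ∂μ) ^ 2 ∂μ) := hcs
    _ ≤ Real.sqrt (∫ ω, X ω ^ 2 ∂μ) * Real.sqrt (∫ ω, Y ω ^ 2 ∂μ) :=
      mul_le_mul (Real.sqrt_le_sqrt hvarX) (Real.sqrt_le_sqrt hvarY) (Real.sqrt_nonneg _)
        (Real.sqrt_nonneg _)

/-- `Cov(a, g ∘ S) = Cov(a, h ∘ S) + Cov(a, (g - h) ∘ S)` for square-integrable data. [folklore] -/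
theorem covariance_comp_eq_add_sub [IsFiniteMeasure μ] {a g h : Ω → ℝ} {S : Ω → Ω}
    (ha : MemLp a 2 μ) (hg : MemLp (g ∘ S) 2 μ) (hh : MemLp (h ∘ S) 2 μ) :
    cov[a, g ∘ S; μ] = cov[a, h ∘ S; μ] + cov[a, (fun ω => g ω - h ω) ∘ S; μ] := by
  have e : g ∘ S = h ∘ S + (fun ω => g ω - h ω) ∘ S := by
    funext ω; simp only [comp_apply, Pi.add_apply]; ring
  have hsub : MemLp ((fun ω => g ω - h ω) ∘ S) 2 μ := by
    have : (fun ω => g ω - h ω) ∘ S = g ∘ S - h ∘ S := by funext ω; rfl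
    rw [this]; exact hg.sub hh
  rw [e, covariance_add_right ha hh hsub]

end Tools

/-! ### §0' Translations of the chain: invariance of second moments, locality bookkeeping -/

section Shift

variable {μ : Measure ChainConfig}

/-- `∫ F ∘ τ_x dμ = ∫ F dμ` for a translation-invariant `μ`. [folklore] -/
theorem integral_comp_chainShift {x : ℤ} (hτ : MeasurePreserving (chainShift x) μ μ)
    {F : ChainConfig → ℝ} (hF : AEStronglyMeasurable F μ) :
    ∫ σ, F (chainShift x σ) ∂μ = ∫ σ, F σ ∂μ := by
  have hF' : AEStronglyMeasurable F (Measure.map (chainShift x) μ) := by rwa [hτ.map_eq]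
  rw [← integral_map hτ.measurable.aemeasurable hF', hτ.map_eq]

/-- `∫ (F ∘ τ_x)² dμ = ∫ F² dμ`. [folklore] -/
theorem integral_sq_comp_chainShift {x : ℤ} (hτ : MeasurePreserving (chainShift x) μ μ)
    {F : ChainConfig → ℝ} (hF : AEStronglyMeasurable F μ) :
    ∫ σ, ((F ∘ chainShift x) σ) ^ 2 ∂μ = ∫ σ, F σ ^ 2 ∂μ := by
  have h := integral_comp_chainShift hτ (F := fun σ => F σ ^ 2) (hF.pow 2)
  simpa only [comp_apply] using h

/-- An observable depending on the sites in `S`, translated by `x`, depends on the sites `j` with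
`j - x ∈ S`. [folklore] -/
theorem dependsOn_comp_chainShift {β : Type*} {f : ChainConfig → β} {S : Set ℤ} (hf : DependsOn f S)
    (x : ℤ) : DependsOn (f ∘ chainShift x) {j : ℤ | j - x ∈ S} := by
  intro σ σ' h
  simp only [comp_apply]
  apply hf
  intro i hi
  simp only [chainShift_apply]
  exact h (i + x) (by simpa using hi)

end Shift

/-! ### §1 The two-sided box form of half-line ρ-mixing -/

section Mixing

variable {μ : Measure ChainConfig} [IsProbabilityMeasure μ] {C m : ℝ}

/-- **Box form of exponential ρ-mixing.** If `μ` is exponentially ρ-mixing between half-lines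
(hypothesis `hmix`, the registered form) and translation invariant, then for `a` depending on the
sites in `[-R, R]` and `h` depending on the sites in `[-M, M]` (measurable, square integrable),
`|Cov_μ(a, h ∘ τ_x)| ≤ max C 1 · e^{-m (|x| - M - R)₊} (∫ a²)^{1/2} (∫ h²)^{1/2}` for every `x ∈ ℤ`
(for `|x| < M + R` this is Cauchy–Schwarz). [folklore] -/
theorem abs_covariance_comp_chainShift_le_of_mixing
    (hmix : ∀ (p : ℤ) (n : ℕ) (f g : ChainConfig → ℝ),
      DependsOn f {i : ℤ | i ≤ p} → DependsOn g {i : ℤ | p + n ≤ i} →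
      Measurable f → Measurable g → MemLp f 2 μ → MemLp g 2 μ →
      |MeasureTheory.integral μ (fun σ => f σ * g σ) -
          MeasureTheory.integral μ f * MeasureTheory.integral μ g| ≤
        C * Real.exp (-(m * n)) * (MeasureTheory.integral μ (fun σ => f σ ^ 2)) ^ (1 / 2 : ℝ) *
          (MeasureTheory.integral μ (fun σ => g σ ^ 2)) ^ (1 / 2 : ℝ))
    (hτ : ∀ x : ℤ, MeasurePreserving (chainShift x) μ μ)
    {a h : ChainConfig → ℝ} {R M : ℕ}
    (ha : DependsOn a (Set.Icc (-(R : ℤ)) R)) (ham : Measurable a) (ha2 : MemLp a 2 μ)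
    (hh : DependsOn h (Set.Icc (-(M : ℤ)) M)) (hhm : Measurable h) (hh2 : MemLp h 2 μ) (x : ℤ) :
    |cov[a, h ∘ chainShift x; μ]| ≤
      max C 1 * Real.exp (-(m * ((|x| - M - R).toNat : ℕ))) *
        Real.sqrt (∫ σ, a σ ^ 2 ∂μ) * Real.sqrt (∫ σ, h σ ^ 2 ∂μ) := by
  set k : ℕ := (|x| - M - R).toNat with hk
  set A := Real.sqrt (∫ σ, a σ ^ 2 ∂μ) with hA
  set B := Real.sqrt (∫ σ, h σ ^ 2 ∂μ) with hB
  have hA0 : 0 ≤ A := Real.sqrt_nonneg _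
  have hB0 : 0 ≤ B := Real.sqrt_nonneg _
  have hhx2 : MemLp (h ∘ chainShift x) 2 μ := hh2.comp_measurePreserving (hτ x)
  have hhxm : Measurable (h ∘ chainShift x) := hhm.comp (chainShift.measurable x)
  have hBx : Real.sqrt (∫ σ, ((h ∘ chainShift x) σ) ^ 2 ∂μ) = B := by
    rw [hB, integral_sq_comp_chainShift (hτ x) hhm.aestronglyMeasurable]
  have hC1 : (1 : ℝ) ≤ max C 1 := le_max_right _ _
  have hC0 : 0 ≤ max C 1 := zero_le_one.trans hC1
  have hexp0 : 0 ≤ Real.exp (-(m * (k : ℕ))) := (Real.exp_pos _).le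
  -- the Cauchy–Schwarz fallback, valid for every `x`
  have hCS : |cov[a, h ∘ chainShift x; μ]| ≤ A * B := by
    have := abs_covariance_le_sqrt_integral_sq_mul ha2 hhx2
    rwa [hBx] at this
  by_cases hfar : (M : ℤ) + R ≤ |x|
  · -- the mixing regime: `k = |x| - M - R`
    have hkz : (k : ℤ) = |x| - M - R := by
      rw [hk, Int.toNat_of_nonneg (by omega)]
    -- rewrite the covariance as `∫ fg - ∫ f ∫ g`
    have hcov : cov[a, h ∘ chainShift x; μ] =
        ∫ σ, a σ * (h ∘ chainShift x) σ ∂μ - (∫ σ, a σ ∂μ) * ∫ σ, (h ∘ chainShift x) σ ∂μ := by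
      rw [covariance_eq_sub ha2 hhx2]; rfl
    have hsqa : (MeasureTheory.integral μ (fun σ => a σ ^ 2)) ^ (1 / 2 : ℝ) = A := by
      rw [hA, Real.sqrt_eq_rpow]
    have hsqh : (MeasureTheory.integral μ (fun σ => (h ∘ chainShift x) σ ^ 2)) ^ (1 / 2 : ℝ) = B := by
      rw [← hBx, Real.sqrt_eq_rpow]
    rcases le_or_gt 0 x with hx0 | hx0
    · -- `x ≥ 0`: `a` sits to the left of `h ∘ τ_x`
      have habs : |x| = x := abs_of_nonneg hx0
      have hf : DependsOn a {i : ℤ | i ≤ R} :=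
        ha.mono fun i hi => (Set.mem_Icc.1 hi).2
      have hg : DependsOn (h ∘ chainShift x) {i : ℤ | (R : ℤ) + k ≤ i} := by
        refine (dependsOn_comp_chainShift hh x).mono fun j hj => ?_
        simp only [Set.mem_setOf_eq, Set.mem_Icc] at hj ⊢
        omega
      have key := hmix R k a (h ∘ chainShift x) hf hg ham hhxm ha2 hhx2
      rw [hsqa, hsqh] at key
      rw [hcov]
      calc |∫ σ, a σ * (h ∘ chainShift x) σ ∂μ - (∫ σ, a σ ∂μ) * ∫ σ, (h ∘ chainShift x) σ ∂μ|
          ≤ C * Real.exp (-(m * k)) * A * B := key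
        _ ≤ max C 1 * Real.exp (-(m * k)) * A * B :=
          mul_le_mul_of_nonneg_right (mul_le_mul_of_nonneg_right
            (mul_le_mul_of_nonneg_right (le_max_left C 1) hexp0) hA0) hB0
    · -- `x < 0`: `h ∘ τ_x` sits to the left of `a`
      have habs : |x| = -x := abs_of_neg hx0
      have hf : DependsOn (h ∘ chainShift x) {i : ℤ | i ≤ x + M} := by
        refine (dependsOn_comp_chainShift hh x).mono fun j hj => ?_
        simp only [Set.mem_setOf_eq, Set.mem_Icc] at hj ⊢
        omega
      have hg : DependsOn a {i : ℤ | (x + M) + k ≤ i} := by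
        refine ha.mono fun i hi => ?_
        simp only [Set.mem_setOf_eq, Set.mem_Icc] at hi ⊢
        omega
      have key := hmix (x + M) k (h ∘ chainShift x) a hf hg hhxm ham hhx2 ha2
      rw [hsqa, hsqh] at key
      have hcov' : cov[a, h ∘ chainShift x; μ] =
          ∫ σ, (h ∘ chainShift x) σ * a σ ∂μ - (∫ σ, (h ∘ chainShift x) σ ∂μ) * ∫ σ, a σ ∂μ := by
        rw [hcov, mul_comm (∫ σ, a σ ∂μ)]
        congr 1
        exact integral_congr_ae (Eventually.of_forall fun σ => mul_comm _ _)
      rw [hcov']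
      calc |∫ σ, (h ∘ chainShift x) σ * a σ ∂μ - (∫ σ, (h ∘ chainShift x) σ ∂μ) * ∫ σ, a σ ∂μ|
          ≤ C * Real.exp (-(m * k)) * B * A := key
        _ ≤ max C 1 * Real.exp (-(m * k)) * B * A :=
          mul_le_mul_of_nonneg_right (mul_le_mul_of_nonneg_right
            (mul_le_mul_of_nonneg_right (le_max_left C 1) hexp0) hB0) hA0
        _ = max C 1 * Real.exp (-(m * k)) * A * B := by ring
  · -- the overlap regime: `k = 0`, Cauchy–Schwarz
    have hk0 : k = 0 := by
      rw [hk, Int.toNat_eq_zero]; omega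
    rw [hk0]
    simp only [Nat.cast_zero, mul_zero, neg_zero, Real.exp_zero, mul_one]
    calc |cov[a, h ∘ chainShift x; μ]| ≤ A * B := hCS
      _ = 1 * A * B := by ring
      _ ≤ max C 1 * A * B := by gcongr

end Mixing

end Literature.MathematicalPhysics.KineticTheory.HeatConduction

end
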